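import Literature.NumberTheory.DiophantineGeometry.TateAlgorithmIstarEvalProofs
import HarnessLib

/-!
# Tate's algorithm in residue characteristic `2`: the `Iₙ*` sub-procedure on two explicit
# families (twisted Tate curves over an absolutely unramified `2`-adic ring)

`Proofs` file (theorems only, no definitions, no named facts) in topic
`NumberTheory/DiophantineGeometry`, companion of `TateAlgorithm`, `TateAlgorithmInvarianceProofs`
and `TateAlgorithmIstarEvalProofs`, landed by the seat of bsd.S15
(`Literature.NumberTheory.EllipticCurves.conductorNorm_eq_artinConductorNat`) as the
discriminant side of Ogg's formula (Silverman, *ATAEC*, IV.11.1) at the **potentially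
multiplicative places of residue characteristic `2`** of an elliptic curve over `ℚ`.

Let `R` be a discrete valuation ring with perfect residue field `k` of characteristic `2` in
which `2` is a uniformiser (`2 = ϖ ε`, `ε ∈ Rˣ`; e.g. `R = ℤ₂`).  We run the `Iₙ*` sub-procedure
of Step 7 of Tate's algorithm (Silverman, *ATAEC*, IV.9.4, PDF p. 346), as implemented by
`istarIndexAux`, on two families of Weierstrass equations:

* **family A** (`istarIndexAux_familyA`): `a₁ = ϖα`, `a₂ = ϖβ`, `a₃ = 0`, `ϖᴺ ∣ a₄`,
  `a₆ = ϖᴺ γ` with `α, β, γ ∈ Rˣ`, `N ≥ 5`: the sub-procedure returns **`n = N - 2`**;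
* **family B** (`istarIndexAux_familyB`): `a₁ = 0`, `a₂ = ϖβ`, `a₃ = 0`, `ϖᴺ⁻¹ ∣ a₄`,
  `a₆ = ϖᴺ γ` with `β, γ ∈ Rˣ`, `N ≥ 7`: the sub-procedure returns **`n = N - 1`**.

These are the shapes of the integral models `y² + 2xy = x³ + (d - 1)x² + 16d²a₄x + 64d³a₆`
(`d ≡ 3 mod 4`) and `y² = x³ + d x² + 16d²a₄x + 64d³a₆` (`2 ∥ d`) of the quadratic twist by `d`
of the Tate normal form `y² + xy = x³ + a₄x + a₆` (`ord₂ a₄ ≥ ord₂ a₆ = -ord₂ j = ν ≥ 1`) over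
`ℤ₂`, for which `N = ν + 6`, resp. `N = ν + 9`, giving the Kodaira types `I*_{ν+4}`, resp.
`I*_{ν+8}` of a potentially multiplicative, additive elliptic curve over `ℚ₂` (the types listed
by S. Comalada, *Twists and reduction of an elliptic curve*, J. Number Theory 49 (1994), for
`p = 2`; here obtained by running Silverman's algorithm literally).

In characteristic `2` the two tests of a round degenerate to *"is `a₃,ₘ₊₂` a unit?"* and
*"is `a₄,ₘ₊₃` a unit?"* (`testA_iff_of_two_eq_zero`, `testB_iff_of_two_eq_zero`: the
discriminants are `a² + 4c = a²` and `b² - 4ac = b²`), all rounds before the first unit shows up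
pass on the same model (`istarIndexAux_succ_of_dvd`, valid in every characteristic), and the one
or two non-trivial translations are written down explicitly (square roots exist in the perfect
residue field, `exists_dvd_sub_sq`, `exists_dvd_add_mul_sq`), the rounds being evaluated with the
API of `TateAlgorithmIstarEvalProofs`.

## References

* J. H. Silverman, *Advanced Topics in the Arithmetic of Elliptic Curves*, GTM 151 (1994),
  IV.9.4 Step 7 (PDF p. 346); IV.11.1 (Ogg's formula). [SilvermanATAEC1994]
* S. Comalada, *Twists and reduction of an elliptic curve*, J. Number Theory 49 (1994), 45–62
  (types of quadratic twists at `p = 2`; cited for context only). [folklore]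
-/

open Polynomial IsLocalRing
open IsDiscreteValuationRing hiding maximalIdeal

namespace Literature.NumberTheory.DiophantineGeometry

namespace TateAlgorithm

variable {R : Type*} [CommRing R] [IsDomain R] [IsDiscreteValuationRing R]

/-! ### Rounds in which every tested coefficient vanishes (any characteristic) -/

/-- **A round with vanishing tests passes to the next round on the same model.**  If `W` is
normalised for round `m` with moreover `ϖ^{m+3} ∣ a₃`, `ϖ^{m+4} ∣ a₄`, `ϖ^{2m+6} ∣ a₆`, then both
quadratics of round `m` are `Y²` resp. `a₂,₁X²` (double roots at `0`), no translation is needed,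
and `istarIndexAux (fuel + 1) m W = istarIndexAux fuel (m + 1) W`.  Silverman *ATAEC* IV.9.4,
Step 7. [cite: SilvermanATAEC1994, IV.9.4 Step 7 (PDF p. 346)] -/
theorem istarIndexAux_succ_of_dvd [PerfectField (ResidueField R)] {fuel m : ℕ}
    {W : WeierstrassCurve R} (h1 : uniformizer R ∣ W.a₁) (h2 : uniformizer R ∣ W.a₂)
    (h2n : ¬ uniformizer R ^ 2 ∣ W.a₂) (h3 : uniformizer R ^ (m + 3) ∣ W.a₃)
    (h4 : uniformizer R ^ (m + 4) ∣ W.a₄) (h6 : uniformizer R ^ (2 * m + 6) ∣ W.a₆) :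
    istarIndexAux (fuel + 1) m W = istarIndexAux fuel (m + 1) W := by
  set ϖ := uniformizer R with hϖdef
  have h3' : ϖ ^ (m + 2) ∣ W.a₃ := (pow_dvd_pow ϖ (by omega)).trans h3
  have h4' : ϖ ^ (m + 3) ∣ W.a₄ := (pow_dvd_pow ϖ (by omega)).trans h4
  have h6' : ϖ ^ (2 * m + 4) ∣ W.a₆ := (pow_dvd_pow ϖ (by omega)).trans h6
  have h6'' : ϖ ^ (2 * m + 5) ∣ W.a₆ := (pow_dvd_pow ϖ (by omega)).trans h6
  have z3 : redCoeff W.a₃ (m + 2) = 0 := redCoeff_eq_zero_of_dvd h3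
  have z6 : redCoeff W.a₆ (2 * m + 4) = 0 := redCoeff_eq_zero_of_dvd h6''
  have z4 : redCoeff W.a₄ (m + 3) = 0 := redCoeff_eq_zero_of_dvd h4
  have z6' : redCoeff W.a₆ (2 * m + 5) = 0 := redCoeff_eq_zero_of_dvd h6
  have ha2 : redCoeff W.a₂ 1 ≠ 0 := by
    rw [Ne, redCoeff_eq_zero_iff (by simpa using h2)]; exact h2n
  have hA : distinctRootCount
      (X ^ 2 + C (redCoeff W.a₃ (m + 2)) * X - C (redCoeff W.a₆ (2 * m + 4))) ≠ 2 := by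
    rw [z3, z6, Ne, distinctRootCount_sq_add_sub_eq_two_iff]; simp
  have hB : distinctRootCount (C (redCoeff W.a₂ 1) * X ^ 2 + C (redCoeff W.a₄ (m + 3)) * X
      + C (redCoeff W.a₆ (2 * m + 5))) ≠ 2 := by
    rw [z4, z6', Ne, distinctRootCount_quadratic_eq_two_iff_ne_zero ha2]; simp
  exact istarIndexAux_succ_of_not_testB (C₁ := 1) (C₂ := 1) h1 h2 h2n h3' h4' h6' hA
    (one_smul _ W).symm h1 h2 h2n h3 h4' h6'' hB (one_smul _ W).symm h1 h2 h2n
    (by simpa using h3) (by simpa using h4) (by simpa [show 2 * (m + 1) + 4 = 2 * m + 6 by ring]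
      using h6)

/-- **All rounds below `M` pass on the same model** when `ϖ^{M+2} ∣ a₃`, `ϖ^{M+3} ∣ a₄`,
`ϖ^{2M+4} ∣ a₆` (and `ϖ ∣ a₁`, `ϖ ∥ a₂`): `istarIndexAux (fuel + k) m W = istarIndexAux fuel M W`
for `m + k = M`.  Silverman *ATAEC* IV.9.4, Step 7.
[cite: SilvermanATAEC1994, IV.9.4 Step 7 (PDF p. 346)] -/
theorem istarIndexAux_add_of_dvd [PerfectField (ResidueField R)] {M : ℕ}
    {W : WeierstrassCurve R} (h1 : uniformizer R ∣ W.a₁) (h2 : uniformizer R ∣ W.a₂)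
    (h2n : ¬ uniformizer R ^ 2 ∣ W.a₂) (h3 : uniformizer R ^ (M + 2) ∣ W.a₃)
    (h4 : uniformizer R ^ (M + 3) ∣ W.a₄) (h6 : uniformizer R ^ (2 * M + 4) ∣ W.a₆) :
    ∀ (k m fuel : ℕ), m + k = M → istarIndexAux (fuel + k) m W = istarIndexAux fuel M W := by
  set ϖ := uniformizer R with hϖdef
  intro k
  induction k with
  | zero => intro m fuel h; simp only [add_zero] at h ⊢; rw [h]
  | succ k ih =>
    intro m fuel h
    have hm : m + 1 + k = M := by omega
    rw [← add_assoc, istarIndexAux_succ_of_dvd h1 h2 h2n ((pow_dvd_pow ϖ (by omega)).trans h3)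
      ((pow_dvd_pow ϖ (by omega)).trans h4) ((pow_dvd_pow ϖ (by omega)).trans h6)]
    exact ih (m + 1) fuel hm

/-! ### The tests in residue characteristic `2`; square roots in the residue field -/

/-- In residue characteristic `2`, `Y² + aY - c` has two distinct roots iff `a ≠ 0`
(its discriminant is `a² + 4c = a²`). [folklore] -/
theorem testA_iff_of_two_eq_zero (h2 : (2 : ResidueField R) = 0) (a c : ResidueField R) :
    distinctRootCount (X ^ 2 + C a * X - C c) = 2 ↔ a ≠ 0 := by
  have h4 : (4 : ResidueField R) = 0 := by rw [show (4 : ResidueField R) = 2 * 2 by norm_num, h2, mul_zero]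
  rw [distinctRootCount_sq_add_sub_eq_two_iff, h4, zero_mul, add_zero]
  exact pow_ne_zero_iff two_ne_zero

/-- In residue characteristic `2`, `aX² + bX + c` (`a ≠ 0`) has two distinct roots iff `b ≠ 0`
(its discriminant is `b² - 4ac = b²`). [folklore] -/
theorem testB_iff_of_two_eq_zero (h2 : (2 : ResidueField R) = 0) {a : ResidueField R}
    (ha : a ≠ 0) (b c : ResidueField R) :
    distinctRootCount (C a * X ^ 2 + C b * X + C c) = 2 ↔ b ≠ 0 := by
  have h4 : (4 : ResidueField R) = 0 := by rw [show (4 : ResidueField R) = 2 * 2 by norm_num, h2, mul_zero]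
  rw [distinctRootCount_quadratic_eq_two_iff_ne_zero ha, h4, zero_mul, zero_mul, sub_zero]
  exact pow_ne_zero_iff two_ne_zero

/-- If `2 = ϖ ε` then `2 = 0` in the residue field. [folklore] -/
theorem residue_two_eq_zero {ε : R} (hε : (2 : R) = uniformizer R * ε) :
    (2 : ResidueField R) = 0 := by
  rw [← map_ofNat (residue R) 2, hε, map_mul,
    residue_uniformizer_eq_zero irreducible_uniformizer, zero_mul]

/-- **Square roots modulo `ϖ`** (perfect residue field of characteristic `2`): every `x ∈ R` is
a square modulo `ϖ`. [folklore] -/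
theorem exists_dvd_sub_sq [PerfectField (ResidueField R)] (h2 : (2 : ResidueField R) = 0)
    (x : R) : ∃ y : R, uniformizer R ∣ x - y ^ 2 := by
  haveI : CharP (ResidueField R) 2 := CharTwo.of_one_ne_zero_of_two_eq_zero one_ne_zero h2
  obtain ⟨yb, hyb⟩ := surjective_frobenius (ResidueField R) 2 (residue R x)
  obtain ⟨y, rfl⟩ := residue_surjective yb
  rw [frobenius_def, ← map_pow] at hyb
  refine ⟨y, (dvd_iff_residue_eq_zero irreducible_uniformizer _).mpr ?_⟩
  rw [map_sub, hyb, sub_self]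

/-- **Square roots modulo `ϖ`, twisted**: for a unit `c`, every `x` satisfies
`ϖ ∣ x + c y²` for some `y` (take `ȳ² = -x̄/c̄`). [folklore] -/
theorem exists_dvd_add_mul_sq [PerfectField (ResidueField R)] (h2 : (2 : ResidueField R) = 0)
    {c : R} (hc : IsUnit c) (x : R) : ∃ y : R, uniformizer R ∣ x + c * y ^ 2 := by
  obtain ⟨c', hc'⟩ := hc.exists_right_inv
  obtain ⟨y, hy⟩ := exists_dvd_sub_sq h2 (-(x * c'))
  refine ⟨y, ?_⟩
  have e : x + c * y ^ 2 = -(c * (-(x * c') - y ^ 2)) + x * (1 - c * c') := by ring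
  rw [e, hc', sub_self, mul_zero, add_zero]
  exact (dvd_mul_of_dvd_right hy c).neg_right

/-- `ϖ ∥ ϖβ` for a unit `β`. [folklore] -/
theorem not_sq_dvd_uniformizer_mul {β : R} (hβ : IsUnit β) :
    ¬ uniformizer R ^ 2 ∣ uniformizer R * β := by
  intro h
  rw [pow_two, mul_dvd_mul_iff_left irreducible_uniformizer.ne_zero] at h
  exact (isUnit_iff_not_dvd irreducible_uniformizer β).mp hβ h


/-- A unit is congruent to no non-unit square: if `ϖ ∣ γ - τ²` with `γ` a unit then `τ` is a
unit. [folklore] -/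
theorem isUnit_of_dvd_sub_sq {γ τ : R} (hγ : IsUnit γ) (h : uniformizer R ∣ γ - τ ^ 2) :
    IsUnit τ := by
  have hϖ : Irreducible (uniformizer R) := irreducible_uniformizer
  rw [isUnit_iff_not_dvd hϖ] at hγ ⊢
  intro hτ
  apply hγ
  have : γ = (γ - τ ^ 2) + τ * τ := by ring
  rw [this]
  exact dvd_add h (dvd_mul_of_dvd_left hτ _)

/-- Twisted version: if `ϖ ∣ γ + β ρ²` with `γ` a unit then `ρ` is a unit. [folklore] -/
theorem isUnit_of_dvd_add_mul_sq {γ β ρ : R} (hγ : IsUnit γ)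
    (h : uniformizer R ∣ γ + β * ρ ^ 2) : IsUnit ρ := by
  have hϖ : Irreducible (uniformizer R) := irreducible_uniformizer
  rw [isUnit_iff_not_dvd hϖ] at hγ ⊢
  intro hρ
  apply hγ
  have : γ = (γ + β * ρ ^ 2) - β * ρ * ρ := by ring
  rw [this]
  exact dvd_sub h (dvd_mul_of_dvd_right hρ _)

/-! ### Family A: `a₁ = ϖα`, `a₂ = ϖβ`, `a₃ = 0`, `ϖᴺ ∣ a₄`, `a₆ = ϖᴺγ` -/

section FamilyA

variable [PerfectField (ResidueField R)]

/-- **Family A, `N = 2m + 4` even.**  With `2 = ϖε` (`ε` a unit), `a₁ = ϖα`, `a₂ = ϖβ`,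
`a₃ = 0`, `ϖ^{2m+4} ∣ a₄`, `a₆ = ϖ^{2m+4}γ` (`α, β, γ` units), the `Iₙ*` sub-procedure returns
`n = 2m + 2`: rounds `0, …, m - 1` pass on the same model; in round `m` the first quadratic is
`Y² - γ̄`, a double root at `τ̄ = √γ̄`; after `y ↦ y + ϖ^{m+2}τ` one has
`a₄ = ϖ^{m+3}(ϖ^{m+1}q - τα)` with `τα` a unit, so the second quadratic
`β̄X² - τ̄ᾱX + ⋯` has distinct roots.  Silverman *ATAEC* IV.9.4, Step 7.
[cite: SilvermanATAEC1994, IV.9.4 Step 7 (PDF p. 346)] -/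
theorem istarIndexAux_familyA_even {m : ℕ} (fuel : ℕ) {W : WeierstrassCurve R} {ε α β γ : R}
    (hε : (2 : R) = uniformizer R * ε) (hεu : IsUnit ε)
    (ha₁ : W.a₁ = uniformizer R * α) (hα : IsUnit α)
    (ha₂ : W.a₂ = uniformizer R * β) (hβ : IsUnit β) (ha₃ : W.a₃ = 0)
    (ha₄ : uniformizer R ^ (2 * m + 4) ∣ W.a₄)
    (ha₆ : W.a₆ = uniformizer R ^ (2 * m + 4) * γ) (hγ : IsUnit γ) :
    istarIndexAux (fuel + 1 + m) 0 W = 2 * m + 2 := by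
  set ϖ := uniformizer R with hϖdef
  have hϖ : Irreducible ϖ := irreducible_uniformizer
  have hres0 : residue R ϖ = 0 := residue_uniformizer_eq_zero hϖ
  have h20 := residue_two_eq_zero hε
  have h1 : ϖ ∣ W.a₁ := ⟨α, ha₁⟩
  have h2 : ϖ ∣ W.a₂ := ⟨β, ha₂⟩
  have h2n : ¬ ϖ ^ 2 ∣ W.a₂ := by rw [ha₂]; exact not_sq_dvd_uniformizer_mul hβ
  have h3 : ∀ n, ϖ ^ n ∣ W.a₃ := fun n => by rw [ha₃]; exact dvd_zero _
  have h6 : ϖ ^ (2 * m + 4) ∣ W.a₆ := ⟨γ, ha₆⟩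
  have _hε := hεu
  -- rounds `0, …, m - 1`
  rw [istarIndexAux_add_of_dvd (M := m) h1 h2 h2n (h3 _) ((pow_dvd_pow ϖ (by omega)).trans ha₄)
    h6 m 0 (fuel + 1) (zero_add m)]
  -- round `m`: the first test fails
  have hA : distinctRootCount
      (X ^ 2 + C (redCoeff W.a₃ (m + 2)) * X - C (redCoeff W.a₆ (2 * m + 4))) ≠ 2 := by
    rw [Ne, testA_iff_of_two_eq_zero h20, not_not, redCoeff_eq_zero_of_dvd (h3 _)]
  -- the `y`-translation `y ↦ y + ϖ^{m+2} τ`, `τ̄² = γ̄`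
  obtain ⟨τ, hτ⟩ := exists_dvd_sub_sq h20 γ
  have hτu : IsUnit τ := isUnit_of_dvd_sub_sq hγ hτ
  obtain ⟨l, hl⟩ := hτ
  obtain ⟨q, hq⟩ := ha₄
  set C₁ : WeierstrassCurve.VariableChange R := ⟨1, 0, 0, ϖ ^ (m + 2) * τ⟩ with hC₁
  have hu₁ : C₁.u = 1 := rfl
  set W₁ := C₁ • W with hW₁
  have e1 : W₁.a₁ = ϖ * α := by
    rw [hW₁, smul_a₁_of_u_eq_one hu₁, ha₁, hC₁]; ring
  have e2 : W₁.a₂ = ϖ * β := by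
    rw [hW₁, smul_a₂_of_u_eq_one hu₁, ha₂, ha₁, hC₁]; ring
  have e3 : W₁.a₃ = ϖ ^ (m + 3) * (ε * τ) := by
    rw [hW₁, smul_a₃_of_u_eq_one hu₁, ha₃, ha₁, hC₁]
    simp only
    linear_combination ϖ ^ (m + 2) * τ * hε
  have e4 : W₁.a₄ = ϖ ^ (m + 3) * (ϖ ^ (m + 1) * q - τ * α) := by
    rw [hW₁, smul_a₄_of_u_eq_one hu₁, ha₃, ha₂, ha₁, hq, hC₁]; ring
  have e6 : W₁.a₆ = ϖ ^ (2 * m + 5) * l := by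
    rw [hW₁, smul_a₆_of_u_eq_one hu₁, ha₃, ha₆, ha₁, hC₁]
    simp only
    linear_combination ϖ ^ (2 * m + 4) * hl
  have k1 : ϖ ∣ W₁.a₁ := ⟨α, e1⟩
  have k2 : ϖ ∣ W₁.a₂ := ⟨β, e2⟩
  have k2n : ¬ ϖ ^ 2 ∣ W₁.a₂ := by rw [e2]; exact not_sq_dvd_uniformizer_mul hβ
  have k3 : ϖ ^ (m + 3) ∣ W₁.a₃ := ⟨_, e3⟩
  have k4 : ϖ ^ (m + 3) ∣ W₁.a₄ := ⟨_, e4⟩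
  have k6 : ϖ ^ (2 * m + 5) ∣ W₁.a₆ := ⟨_, e6⟩
  -- the second test fires: `a₄,ₘ₊₃ = -τ̄ᾱ ≠ 0`
  have ha2 : redCoeff W₁.a₂ 1 ≠ 0 := by
    rw [e2, redCoeff_uniformizer_mul]; exact (isUnit_iff_residue_ne_zero β).mp hβ
  have hb : redCoeff W₁.a₄ (m + 3) ≠ 0 := by
    rw [e4, redCoeff_uniformizer_pow_mul, map_sub, map_mul, map_mul, map_pow, hres0,
      zero_pow (Nat.succ_ne_zero _), zero_mul, zero_sub, neg_ne_zero]
    exact mul_ne_zero ((isUnit_iff_residue_ne_zero τ).mp hτu) ((isUnit_iff_residue_ne_zero α).mp hα)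
  have hB : distinctRootCount (C (redCoeff W₁.a₂ 1) * X ^ 2 + C (redCoeff W₁.a₄ (m + 3)) * X
      + C (redCoeff W₁.a₆ (2 * m + 5))) = 2 := (testB_iff_of_two_eq_zero h20 ha2 _ _).mpr hb
  exact istarIndexAux_succ_of_testB h1 h2 h2n (h3 _) ((pow_dvd_pow ϖ (by omega)).trans ⟨q, hq⟩)
    h6 hA hW₁ k1 k2 k2n k3 k4 k6 hB

/-- **Family A, `N = 2m + 5` odd.**  With `2 = ϖε`, `a₁ = ϖα`, `a₂ = ϖβ`, `a₃ = 0`,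
`ϖ^{2m+5} ∣ a₄`, `a₆ = ϖ^{2m+5}γ` (`ε, α, β, γ` units), the `Iₙ*` sub-procedure returns
`n = 2m + 3`: rounds `0, …, m - 1` pass on the same model; in round `m` both quadratics are
degenerate (`Y²` and `β̄X² + γ̄`), the second having the double root `ρ̄ = √(γ̄/β̄) ≠ 0`; after
`x ↦ x + ϖ^{m+2}ρ` one has `a₃ = ϖ^{m+3}ρα`, and in round `m + 1` the first quadratic
`Y² + ρ̄ᾱ Y + ⋯` has distinct roots.  Silverman *ATAEC* IV.9.4, Step 7.
[cite: SilvermanATAEC1994, IV.9.4 Step 7 (PDF p. 346)] -/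
theorem istarIndexAux_familyA_odd {m : ℕ} (fuel : ℕ) {W : WeierstrassCurve R} {ε α β γ : R}
    (hε : (2 : R) = uniformizer R * ε) (hεu : IsUnit ε)
    (ha₁ : W.a₁ = uniformizer R * α) (hα : IsUnit α)
    (ha₂ : W.a₂ = uniformizer R * β) (hβ : IsUnit β) (ha₃ : W.a₃ = 0)
    (ha₄ : uniformizer R ^ (2 * m + 5) ∣ W.a₄)
    (ha₆ : W.a₆ = uniformizer R ^ (2 * m + 5) * γ) (hγ : IsUnit γ) :
    istarIndexAux (fuel + 2 + m) 0 W = 2 * m + 3 := by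
  set ϖ := uniformizer R with hϖdef
  have hϖ : Irreducible ϖ := irreducible_uniformizer
  have hres0 : residue R ϖ = 0 := residue_uniformizer_eq_zero hϖ
  have h20 := residue_two_eq_zero hε
  have h1 : ϖ ∣ W.a₁ := ⟨α, ha₁⟩
  have h2 : ϖ ∣ W.a₂ := ⟨β, ha₂⟩
  have h2n : ¬ ϖ ^ 2 ∣ W.a₂ := by rw [ha₂]; exact not_sq_dvd_uniformizer_mul hβ
  have h3 : ∀ n, ϖ ^ n ∣ W.a₃ := fun n => by rw [ha₃]; exact dvd_zero _
  have h6 : ϖ ^ (2 * m + 5) ∣ W.a₆ := ⟨γ, ha₆⟩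
  have _hε := hεu
  -- rounds `0, …, m - 1`
  rw [istarIndexAux_add_of_dvd (M := m) h1 h2 h2n (h3 _) ((pow_dvd_pow ϖ (by omega)).trans ha₄)
    ((pow_dvd_pow ϖ (by omega)).trans h6) m 0 (fuel + 2) (zero_add m),
    show fuel + 2 = fuel + 1 + 1 by ring]
  -- round `m`: both tests fail on `W` itself
  have hA : distinctRootCount
      (X ^ 2 + C (redCoeff W.a₃ (m + 2)) * X - C (redCoeff W.a₆ (2 * m + 4))) ≠ 2 := by
    rw [Ne, testA_iff_of_two_eq_zero h20, not_not, redCoeff_eq_zero_of_dvd (h3 _)]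
  have ha2 : redCoeff W.a₂ 1 ≠ 0 := by
    rw [ha₂, redCoeff_uniformizer_mul]; exact (isUnit_iff_residue_ne_zero β).mp hβ
  have hB : distinctRootCount (C (redCoeff W.a₂ 1) * X ^ 2 + C (redCoeff W.a₄ (m + 3)) * X
      + C (redCoeff W.a₆ (2 * m + 5))) ≠ 2 := by
    rw [Ne, testB_iff_of_two_eq_zero h20 ha2, not_not,
      redCoeff_eq_zero_of_dvd ((pow_dvd_pow ϖ (by omega)).trans ha₄)]
  -- the `x`-translation `x ↦ x + ϖ^{m+2} ρ`, `ρ̄² = γ̄/β̄`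
  obtain ⟨ρ, hρ⟩ := exists_dvd_add_mul_sq h20 hβ γ
  have hρu : IsUnit ρ := isUnit_of_dvd_add_mul_sq hγ hρ
  obtain ⟨l, hl⟩ := hρ
  obtain ⟨q, hq⟩ := ha₄
  set C₂ : WeierstrassCurve.VariableChange R := ⟨1, ϖ ^ (m + 2) * ρ, 0, 0⟩ with hC₂
  have hu₂ : C₂.u = 1 := rfl
  set W₂ := C₂ • W with hW₂
  have e1 : W₂.a₁ = ϖ * α := by
    rw [hW₂, smul_a₁_of_u_eq_one hu₂, ha₁, hC₂]; ring
  have e2 : W₂.a₂ = ϖ * (β + ϖ * (3 * ϖ ^ m * ρ)) := by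
    rw [hW₂, smul_a₂_of_u_eq_one hu₂, ha₂, ha₁, hC₂]; ring
  have e3 : W₂.a₃ = ϖ ^ (m + 3) * (ρ * α) := by
    rw [hW₂, smul_a₃_of_u_eq_one hu₂, ha₃, ha₁, hC₂]; ring
  have e4 : W₂.a₄ = ϖ ^ (m + 4) * (ϖ ^ (m + 1) * q + ε * ρ * β + 3 * ϖ ^ m * ρ ^ 2) := by
    rw [hW₂, smul_a₄_of_u_eq_one hu₂, ha₃, ha₂, ha₁, hq, hC₂]
    simp only
    linear_combination ϖ ^ (m + 2) * ρ * (ϖ * β) * hε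
  have e6 : W₂.a₆ = ϖ ^ (2 * m + 6) * (l + ϖ ^ (m + 1) * ρ * q + ϖ ^ m * ρ ^ 3) := by
    rw [hW₂, smul_a₆_of_u_eq_one hu₂, ha₃, ha₆, ha₁, ha₂, hq, hC₂]
    simp only
    linear_combination ϖ ^ (2 * m + 5) * hl
  have hβ' : IsUnit (β + ϖ * (3 * ϖ ^ m * ρ)) := isUnit_add_mul_of_isUnit hϖ hβ _
  have j1 : ϖ ∣ W₂.a₁ := ⟨α, e1⟩
  have j2 : ϖ ∣ W₂.a₂ := ⟨_, e2⟩
  have j2n : ¬ ϖ ^ 2 ∣ W₂.a₂ := by rw [e2]; exact not_sq_dvd_uniformizer_mul hβ'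
  have j3 : ϖ ^ (m + 1 + 2) ∣ W₂.a₃ := ⟨_, e3⟩
  have j4 : ϖ ^ (m + 1 + 3) ∣ W₂.a₄ := ⟨_, e4⟩
  have j6 : ϖ ^ (2 * (m + 1) + 4) ∣ W₂.a₆ := by
    rw [show 2 * (m + 1) + 4 = 2 * m + 6 by ring]; exact ⟨_, e6⟩
  rw [istarIndexAux_succ_of_not_testB (C₁ := 1) h1 h2 h2n (h3 _)
    ((pow_dvd_pow ϖ (by omega)).trans ⟨q, hq⟩) ((pow_dvd_pow ϖ (by omega)).trans h6) hA
    (one_smul _ W).symm h1 h2 h2n (h3 _) ((pow_dvd_pow ϖ (by omega)).trans ⟨q, hq⟩) h6 hB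
    hW₂ j1 j2 j2n j3 j4 j6]
  -- round `m + 1`: the first test fires, `a₃,ₘ₊₃ = ρ̄ᾱ ≠ 0`
  refine (istarIndexAux_succ_of_testA fuel (m + 1) W₂ ?_).trans (by ring)
  rw [testA_iff_of_two_eq_zero h20, show m + 1 + 2 = m + 3 by ring, e3,
    redCoeff_uniformizer_pow_mul, map_mul]
  exact mul_ne_zero ((isUnit_iff_residue_ne_zero ρ).mp hρu) ((isUnit_iff_residue_ne_zero α).mp hα)

end FamilyA

/-! ### Family B: `a₁ = 0`, `a₂ = ϖβ`, `a₃ = 0`, `ϖᴺ⁻¹ ∣ a₄`, `a₆ = ϖᴺγ` -/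

section FamilyB

variable [PerfectField (ResidueField R)]

/-- **Family B, `N = 2m + 6` even.**  With `2 = ϖε` (`ε` a unit), `a₁ = 0`, `a₂ = ϖβ`,
`a₃ = 0`, `ϖ^{2m+5} ∣ a₄`, `a₆ = ϖ^{2m+6}γ` (`β, γ` units), the `Iₙ*` sub-procedure returns
`n = 2m + 5`: rounds `0, …, m` pass on the same model; in round `m + 1` the first quadratic
`Y² - γ̄` has the double root `τ̄ = √γ̄ ≠ 0`, and after `y ↦ y + ϖ^{m+3}τ` (which creates
`a₃ = 2ϖ^{m+3}τ = ϖ^{m+4}ετ`) the second quadratic is still degenerate (`a₄` is untouched as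
`a₁ = 0`); after the `x`-translation of the algorithm, round `m + 2` finds
`a₃,ₘ₊₄ = ε̄τ̄ ≠ 0`.  Silverman *ATAEC* IV.9.4, Step 7.
[cite: SilvermanATAEC1994, IV.9.4 Step 7 (PDF p. 346)] -/
theorem istarIndexAux_familyB_even {m : ℕ} (fuel : ℕ) {W : WeierstrassCurve R} {ε β γ : R}
    (hε : (2 : R) = uniformizer R * ε) (hεu : IsUnit ε) (ha₁ : W.a₁ = 0)
    (ha₂ : W.a₂ = uniformizer R * β) (hβ : IsUnit β) (ha₃ : W.a₃ = 0)
    (ha₄ : uniformizer R ^ (2 * m + 5) ∣ W.a₄)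
    (ha₆ : W.a₆ = uniformizer R ^ (2 * m + 6) * γ) (hγ : IsUnit γ) :
    istarIndexAux (fuel + 2 + (m + 1)) 0 W = 2 * m + 5 := by
  set ϖ := uniformizer R with hϖdef
  have hϖ : Irreducible ϖ := irreducible_uniformizer
  have hres0 : residue R ϖ = 0 := residue_uniformizer_eq_zero hϖ
  have h20 := residue_two_eq_zero hε
  have h1 : ϖ ∣ W.a₁ := by rw [ha₁]; exact dvd_zero _
  have h2 : ϖ ∣ W.a₂ := ⟨β, ha₂⟩
  have h2n : ¬ ϖ ^ 2 ∣ W.a₂ := by rw [ha₂]; exact not_sq_dvd_uniformizer_mul hβ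
  have h3 : ∀ n, ϖ ^ n ∣ W.a₃ := fun n => by rw [ha₃]; exact dvd_zero _
  have h6 : ϖ ^ (2 * m + 6) ∣ W.a₆ := ⟨γ, ha₆⟩
  -- rounds `0, …, m`
  rw [istarIndexAux_add_of_dvd (M := m + 1) h1 h2 h2n (h3 _)
    ((pow_dvd_pow ϖ (by omega)).trans ha₄) ((pow_dvd_pow ϖ (by omega)).trans h6) (m + 1) 0
    (fuel + 2) (zero_add _), show fuel + 2 = fuel + 1 + 1 by ring]
  -- round `m + 1`: the first test fails
  have hA : distinctRootCount
      (X ^ 2 + C (redCoeff W.a₃ (m + 1 + 2)) * X - C (redCoeff W.a₆ (2 * (m + 1) + 4))) ≠ 2 := by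
    rw [Ne, testA_iff_of_two_eq_zero h20, not_not, redCoeff_eq_zero_of_dvd (h3 _)]
  -- the `y`-translation `y ↦ y + ϖ^{m+3} τ`, `τ̄² = γ̄`
  obtain ⟨τ, hτ⟩ := exists_dvd_sub_sq h20 γ
  have hτu : IsUnit τ := isUnit_of_dvd_sub_sq hγ hτ
  obtain ⟨l, hl⟩ := hτ
  obtain ⟨q, hq⟩ := ha₄
  set C₁ : WeierstrassCurve.VariableChange R := ⟨1, 0, 0, ϖ ^ (m + 3) * τ⟩ with hC₁
  have hu₁ : C₁.u = 1 := rfl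
  set W₁ := C₁ • W with hW₁
  have e1 : W₁.a₁ = 0 := by
    rw [hW₁, smul_a₁_of_u_eq_one hu₁, ha₁, hC₁]; ring
  have e2 : W₁.a₂ = ϖ * β := by
    rw [hW₁, smul_a₂_of_u_eq_one hu₁, ha₂, ha₁, hC₁]; ring
  have e3 : W₁.a₃ = ϖ ^ (m + 4) * (ε * τ) := by
    rw [hW₁, smul_a₃_of_u_eq_one hu₁, ha₃, ha₁, hC₁]
    simp only
    linear_combination ϖ ^ (m + 3) * τ * hε
  have e4 : W₁.a₄ = ϖ ^ (2 * m + 5) * q := by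
    rw [hW₁, smul_a₄_of_u_eq_one hu₁, ha₃, ha₂, ha₁, hq, hC₁]; ring
  have e6 : W₁.a₆ = ϖ ^ (2 * m + 7) * l := by
    rw [hW₁, smul_a₆_of_u_eq_one hu₁, ha₃, ha₆, ha₁, hC₁]
    simp only
    linear_combination ϖ ^ (2 * m + 6) * hl
  have k1 : ϖ ∣ W₁.a₁ := by rw [e1]; exact dvd_zero _
  have k2 : ϖ ∣ W₁.a₂ := ⟨β, e2⟩
  have k2n : ¬ ϖ ^ 2 ∣ W₁.a₂ := by rw [e2]; exact not_sq_dvd_uniformizer_mul hβ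
  have k3 : ϖ ^ (m + 1 + 3) ∣ W₁.a₃ := ⟨_, e3⟩
  have k4 : ϖ ^ (m + 1 + 3) ∣ W₁.a₄ := (pow_dvd_pow ϖ (by omega)).trans ⟨_, e4⟩
  have k6 : ϖ ^ (2 * (m + 1) + 5) ∣ W₁.a₆ := ⟨_, e6⟩
  -- the second test fails: `a₄,ₘ₊₄ = 0`
  have ha2 : redCoeff W₁.a₂ 1 ≠ 0 := by
    rw [e2, redCoeff_uniformizer_mul]; exact (isUnit_iff_residue_ne_zero β).mp hβ
  have hB : distinctRootCount (C (redCoeff W₁.a₂ 1) * X ^ 2 + C (redCoeff W₁.a₄ (m + 1 + 3)) * X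
      + C (redCoeff W₁.a₆ (2 * (m + 1) + 5))) ≠ 2 := by
    rw [Ne, testB_iff_of_two_eq_zero h20 ha2, not_not, show m + 1 + 3 = m + 4 by ring,
      redCoeff_eq_zero_of_dvd ((pow_dvd_pow ϖ (by omega)).trans ⟨_, e4⟩)]
  -- the `x`-translation `x ↦ x + ϖ^{m+3} ρ`, `ρ̄² = -l̄/β̄`
  obtain ⟨ρ, hρ⟩ := exists_dvd_add_mul_sq h20 hβ l
  obtain ⟨l', hl'⟩ := hρ
  set C₂ : WeierstrassCurve.VariableChange R := ⟨1, ϖ ^ (m + 3) * ρ, 0, 0⟩ with hC₂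
  have hu₂ : C₂.u = 1 := rfl
  set W₂ := C₂ • W₁ with hW₂
  have f1 : W₂.a₁ = 0 := by
    rw [hW₂, smul_a₁_of_u_eq_one hu₂, e1, hC₂]; ring
  have f2 : W₂.a₂ = ϖ * (β + ϖ * (3 * ϖ ^ (m + 1) * ρ)) := by
    rw [hW₂, smul_a₂_of_u_eq_one hu₂, e2, e1, hC₂]; ring
  have f3 : W₂.a₃ = ϖ ^ (m + 4) * (ε * τ) := by
    rw [hW₂, smul_a₃_of_u_eq_one hu₂, e3, e1, hC₂]; ring
  have f4 : W₂.a₄ = ϖ ^ (m + 5) * (ϖ ^ m * q + ε * ρ * β + 3 * ϖ ^ (m + 1) * ρ ^ 2) := by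
    rw [hW₂, smul_a₄_of_u_eq_one hu₂, e3, e2, e1, e4, hC₂]
    simp only
    linear_combination ϖ ^ (m + 3) * ρ * (ϖ * β) * hε
  have f6 : W₂.a₆ = ϖ ^ (2 * m + 8) * (l' + ϖ ^ m * ρ * q + ϖ ^ (m + 1) * ρ ^ 3) := by
    rw [hW₂, smul_a₆_of_u_eq_one hu₂, e3, e6, e1, e2, e4, hC₂]
    simp only
    linear_combination ϖ ^ (2 * m + 7) * hl'
  have hβ' : IsUnit (β + ϖ * (3 * ϖ ^ (m + 1) * ρ)) := isUnit_add_mul_of_isUnit hϖ hβ _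
  have j1 : ϖ ∣ W₂.a₁ := by rw [f1]; exact dvd_zero _
  have j2 : ϖ ∣ W₂.a₂ := ⟨_, f2⟩
  have j2n : ¬ ϖ ^ 2 ∣ W₂.a₂ := by rw [f2]; exact not_sq_dvd_uniformizer_mul hβ'
  have j3 : ϖ ^ (m + 1 + 1 + 2) ∣ W₂.a₃ := ⟨_, f3⟩
  have j4 : ϖ ^ (m + 1 + 1 + 3) ∣ W₂.a₄ := ⟨_, f4⟩
  have j6 : ϖ ^ (2 * (m + 1 + 1) + 4) ∣ W₂.a₆ := by
    rw [show 2 * (m + 1 + 1) + 4 = 2 * m + 8 by ring]; exact ⟨_, f6⟩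
  rw [istarIndexAux_succ_of_not_testB h1 h2 h2n (h3 _) ((pow_dvd_pow ϖ (by omega)).trans ⟨q, hq⟩)
    ((pow_dvd_pow ϖ (by omega)).trans h6) hA hW₁ k1 k2 k2n k3 k4 k6 hB hW₂ j1 j2 j2n j3 j4 j6]
  -- round `m + 2`: the first test fires, `a₃,ₘ₊₄ = ε̄τ̄ ≠ 0`
  refine (istarIndexAux_succ_of_testA fuel (m + 1 + 1) W₂ ?_).trans (by ring)
  rw [testA_iff_of_two_eq_zero h20, show m + 1 + 1 + 2 = m + 4 by ring, f3,
    redCoeff_uniformizer_pow_mul, map_mul]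
  exact mul_ne_zero ((isUnit_iff_residue_ne_zero ε).mp hεu) ((isUnit_iff_residue_ne_zero τ).mp hτu)

/-- **Family B, `N = 2m + 7` odd.**  With `2 = ϖε` (`ε` a unit), `a₁ = 0`, `a₂ = ϖβ`,
`a₃ = 0`, `ϖ^{2m+6} ∣ a₄`, `a₆ = ϖ^{2m+7}γ` (`β, γ` units), the `Iₙ*` sub-procedure returns
`n = 2m + 6`: rounds `0, …, m` pass on the same model; in round `m + 1` both quadratics are
degenerate, the second (`β̄X² + γ̄`) with the double root `ρ̄ = √(γ̄/β̄) ≠ 0`; the translation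
`x ↦ x + ϖ^{m+3}ρ` creates `a₄ = ϖ^{m+5}(ερβ + ϖ(⋯))` (through `2ra₂`); in round `m + 2` the
first quadratic is again `Y² - c̄` (as `a₃ = 0`), and after its `y`-translation the second
quadratic has `a₄,ₘ₊₅ = ε̄ρ̄β̄ ≠ 0`.  Silverman *ATAEC* IV.9.4, Step 7.
[cite: SilvermanATAEC1994, IV.9.4 Step 7 (PDF p. 346)] -/
theorem istarIndexAux_familyB_odd {m : ℕ} (fuel : ℕ) {W : WeierstrassCurve R} {ε β γ : R}
    (hε : (2 : R) = uniformizer R * ε) (hεu : IsUnit ε) (ha₁ : W.a₁ = 0)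
    (ha₂ : W.a₂ = uniformizer R * β) (hβ : IsUnit β) (ha₃ : W.a₃ = 0)
    (ha₄ : uniformizer R ^ (2 * m + 6) ∣ W.a₄)
    (ha₆ : W.a₆ = uniformizer R ^ (2 * m + 7) * γ) (hγ : IsUnit γ) :
    istarIndexAux (fuel + 2 + (m + 1)) 0 W = 2 * m + 6 := by
  set ϖ := uniformizer R with hϖdef
  have hϖ : Irreducible ϖ := irreducible_uniformizer
  have hres0 : residue R ϖ = 0 := residue_uniformizer_eq_zero hϖ
  have h20 := residue_two_eq_zero hε
  have h1 : ϖ ∣ W.a₁ := by rw [ha₁]; exact dvd_zero _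
  have h2 : ϖ ∣ W.a₂ := ⟨β, ha₂⟩
  have h2n : ¬ ϖ ^ 2 ∣ W.a₂ := by rw [ha₂]; exact not_sq_dvd_uniformizer_mul hβ
  have h3 : ∀ n, ϖ ^ n ∣ W.a₃ := fun n => by rw [ha₃]; exact dvd_zero _
  have h6 : ϖ ^ (2 * m + 7) ∣ W.a₆ := ⟨γ, ha₆⟩
  -- rounds `0, …, m`
  rw [istarIndexAux_add_of_dvd (M := m + 1) h1 h2 h2n (h3 _)
    ((pow_dvd_pow ϖ (by omega)).trans ha₄) ((pow_dvd_pow ϖ (by omega)).trans h6) (m + 1) 0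
    (fuel + 2) (zero_add _), show fuel + 2 = fuel + 1 + 1 by ring]
  -- round `m + 1`: both tests fail on `W` itself
  have hA : distinctRootCount
      (X ^ 2 + C (redCoeff W.a₃ (m + 1 + 2)) * X - C (redCoeff W.a₆ (2 * (m + 1) + 4))) ≠ 2 := by
    rw [Ne, testA_iff_of_two_eq_zero h20, not_not, redCoeff_eq_zero_of_dvd (h3 _)]
  have ha2 : redCoeff W.a₂ 1 ≠ 0 := by
    rw [ha₂, redCoeff_uniformizer_mul]; exact (isUnit_iff_residue_ne_zero β).mp hβ
  have hB : distinctRootCount (C (redCoeff W.a₂ 1) * X ^ 2 + C (redCoeff W.a₄ (m + 1 + 3)) * X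
      + C (redCoeff W.a₆ (2 * (m + 1) + 5))) ≠ 2 := by
    rw [Ne, testB_iff_of_two_eq_zero h20 ha2, not_not, show m + 1 + 3 = m + 4 by ring,
      redCoeff_eq_zero_of_dvd ((pow_dvd_pow ϖ (by omega)).trans ha₄)]
  -- the `x`-translation `x ↦ x + ϖ^{m+3} ρ`, `ρ̄² = γ̄/β̄`
  obtain ⟨ρ, hρ⟩ := exists_dvd_add_mul_sq h20 hβ γ
  have hρu : IsUnit ρ := isUnit_of_dvd_add_mul_sq hγ hρ
  obtain ⟨l, hl⟩ := hρ
  obtain ⟨q, hq⟩ := ha₄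
  set C₂ : WeierstrassCurve.VariableChange R := ⟨1, ϖ ^ (m + 3) * ρ, 0, 0⟩ with hC₂
  have hu₂ : C₂.u = 1 := rfl
  set W₂ := C₂ • W with hW₂
  have e1 : W₂.a₁ = 0 := by
    rw [hW₂, smul_a₁_of_u_eq_one hu₂, ha₁, hC₂]; ring
  have e2 : W₂.a₂ = ϖ * (β + ϖ * (3 * ϖ ^ (m + 1) * ρ)) := by
    rw [hW₂, smul_a₂_of_u_eq_one hu₂, ha₂, ha₁, hC₂]; ring
  have e3 : W₂.a₃ = 0 := by
    rw [hW₂, smul_a₃_of_u_eq_one hu₂, ha₃, ha₁, hC₂]; ring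
  have e4 : W₂.a₄ = ϖ ^ (m + 5) * (ε * ρ * β + ϖ * (ϖ ^ m * q + 3 * ϖ ^ m * ρ ^ 2)) := by
    rw [hW₂, smul_a₄_of_u_eq_one hu₂, ha₃, ha₂, ha₁, hq, hC₂]
    simp only
    linear_combination ϖ ^ (m + 3) * ρ * (ϖ * β) * hε
  have e6 : W₂.a₆ = ϖ ^ (2 * m + 8) * (l + ϖ ^ (m + 1) * (ρ * q + ρ ^ 3)) := by
    rw [hW₂, smul_a₆_of_u_eq_one hu₂, ha₃, ha₆, ha₁, ha₂, hq, hC₂]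
    simp only
    linear_combination ϖ ^ (2 * m + 7) * hl
  have hβ' : IsUnit (β + ϖ * (3 * ϖ ^ (m + 1) * ρ)) := isUnit_add_mul_of_isUnit hϖ hβ _
  have hb' : IsUnit (ε * ρ * β + ϖ * (ϖ ^ m * q + 3 * ϖ ^ m * ρ ^ 2)) :=
    isUnit_add_mul_of_isUnit hϖ ((hεu.mul hρu).mul hβ) _
  have j1 : ϖ ∣ W₂.a₁ := by rw [e1]; exact dvd_zero _
  have j2 : ϖ ∣ W₂.a₂ := ⟨_, e2⟩
  have j2n : ¬ ϖ ^ 2 ∣ W₂.a₂ := by rw [e2]; exact not_sq_dvd_uniformizer_mul hβ'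
  have j3 : ∀ n, ϖ ^ n ∣ W₂.a₃ := fun n => by rw [e3]; exact dvd_zero _
  have j4 : ϖ ^ (m + 1 + 1 + 3) ∣ W₂.a₄ := ⟨_, e4⟩
  have j6 : ϖ ^ (2 * (m + 1 + 1) + 4) ∣ W₂.a₆ := by
    rw [show 2 * (m + 1 + 1) + 4 = 2 * m + 8 by ring]; exact ⟨_, e6⟩
  rw [istarIndexAux_succ_of_not_testB (C₁ := 1) h1 h2 h2n (h3 _)
    ((pow_dvd_pow ϖ (by omega)).trans ⟨q, hq⟩) ((pow_dvd_pow ϖ (by omega)).trans h6) hA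
    (one_smul _ W).symm h1 h2 h2n (h3 _) ((pow_dvd_pow ϖ (by omega)).trans ⟨q, hq⟩)
    ((pow_dvd_pow ϖ (by omega)).trans h6) hB hW₂ j1 j2 j2n (j3 _) j4 j6]
  -- round `m + 2`: the first test fails (`a₃ = 0`)
  have hA' : distinctRootCount
      (X ^ 2 + C (redCoeff W₂.a₃ (m + 1 + 1 + 2)) * X
        - C (redCoeff W₂.a₆ (2 * (m + 1 + 1) + 4))) ≠ 2 := by
    rw [Ne, testA_iff_of_two_eq_zero h20, not_not, redCoeff_eq_zero_of_dvd (j3 _)]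
  -- its `y`-translation `y ↦ y + ϖ^{m+4} τ`
  set L := l + ϖ ^ (m + 1) * (ρ * q + ρ ^ 3) with hL
  obtain ⟨τ, hτ⟩ := exists_dvd_sub_sq h20 L
  obtain ⟨l'', hl''⟩ := hτ
  set C₃ : WeierstrassCurve.VariableChange R := ⟨1, 0, 0, ϖ ^ (m + 4) * τ⟩ with hC₃
  have hu₃ : C₃.u = 1 := rfl
  set W₃ := C₃ • W₂ with hW₃
  have g1 : W₃.a₁ = 0 := by
    rw [hW₃, smul_a₁_of_u_eq_one hu₃, e1, hC₃]; ring
  have g2 : W₃.a₂ = ϖ * (β + ϖ * (3 * ϖ ^ (m + 1) * ρ)) := by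
    rw [hW₃, smul_a₂_of_u_eq_one hu₃, e2, e1, hC₃]; ring
  have g3 : W₃.a₃ = ϖ ^ (m + 5) * (ε * τ) := by
    rw [hW₃, smul_a₃_of_u_eq_one hu₃, e3, e1, hC₃]
    simp only
    linear_combination ϖ ^ (m + 4) * τ * hε
  have g4 : W₃.a₄ = ϖ ^ (m + 5) * (ε * ρ * β + ϖ * (ϖ ^ m * q + 3 * ϖ ^ m * ρ ^ 2)) := by
    rw [hW₃, smul_a₄_of_u_eq_one hu₃, e3, e2, e1, e4, hC₃]; ring
  have g6 : W₃.a₆ = ϖ ^ (2 * m + 9) * l'' := by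
    rw [hW₃, smul_a₆_of_u_eq_one hu₃, e3, e6, e1, hC₃]
    simp only
    linear_combination ϖ ^ (2 * m + 8) * hl''
  have k1 : ϖ ∣ W₃.a₁ := by rw [g1]; exact dvd_zero _
  have k2 : ϖ ∣ W₃.a₂ := ⟨_, g2⟩
  have k2n : ¬ ϖ ^ 2 ∣ W₃.a₂ := by rw [g2]; exact not_sq_dvd_uniformizer_mul hβ'
  have k3 : ϖ ^ (m + 1 + 1 + 3) ∣ W₃.a₃ := ⟨_, g3⟩
  have k4 : ϖ ^ (m + 1 + 1 + 3) ∣ W₃.a₄ := ⟨_, g4⟩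
  have k6 : ϖ ^ (2 * (m + 1 + 1) + 5) ∣ W₃.a₆ := ⟨_, g6⟩
  -- the second test fires: `a₄,ₘ₊₅ = ε̄ρ̄β̄ ≠ 0`
  have ha2' : redCoeff W₃.a₂ 1 ≠ 0 := by
    rw [g2, redCoeff_uniformizer_mul]; exact (isUnit_iff_residue_ne_zero _).mp hβ'
  have hb : redCoeff W₃.a₄ (m + 1 + 1 + 3) ≠ 0 := by
    rw [show m + 1 + 1 + 3 = m + 5 by ring, g4, redCoeff_uniformizer_pow_mul]
    exact (isUnit_iff_residue_ne_zero _).mp hb'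
  have hB' : distinctRootCount (C (redCoeff W₃.a₂ 1) * X ^ 2
      + C (redCoeff W₃.a₄ (m + 1 + 1 + 3)) * X + C (redCoeff W₃.a₆ (2 * (m + 1 + 1) + 5))) = 2 :=
    (testB_iff_of_two_eq_zero h20 ha2' _ _).mpr hb
  refine (istarIndexAux_succ_of_testB j1 j2 j2n (j3 _) ((pow_dvd_pow ϖ (by omega)).trans j4)
    ((pow_dvd_pow ϖ (by omega)).trans j6) hA' hW₃ k1 k2 k2n k3 k4 k6 hB').trans (by ring)

end FamilyB

/-! ### Wrappers: arbitrary `N`, and the Kodaira symbol -/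

section Wrappers

variable [PerfectField (ResidueField R)]

/-- **Family A**: `2 = ϖε`, `a₁ = ϖα`, `a₂ = ϖβ`, `a₃ = 0`, `ϖᴺ ∣ a₄`, `a₆ = ϖᴺγ` (`ε, α, β, γ`
units), `N ≥ 5`: with any fuel `≥ N` the `Iₙ*` sub-procedure returns `n = N - 2`.
Silverman *ATAEC* IV.9.4, Step 7. [cite: SilvermanATAEC1994, IV.9.4 Step 7 (PDF p. 346)] -/
theorem istarIndexAux_familyA {N fuel : ℕ} (hN : 5 ≤ N) (hfuel : N ≤ fuel) {W : WeierstrassCurve R}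
    {ε α β γ : R} (hε : (2 : R) = uniformizer R * ε) (hεu : IsUnit ε)
    (ha₁ : W.a₁ = uniformizer R * α) (hα : IsUnit α)
    (ha₂ : W.a₂ = uniformizer R * β) (hβ : IsUnit β) (ha₃ : W.a₃ = 0)
    (ha₄ : uniformizer R ^ N ∣ W.a₄) (ha₆ : W.a₆ = uniformizer R ^ N * γ) (hγ : IsUnit γ) :
    istarIndexAux fuel 0 W = N - 2 := by
  rcases Nat.even_or_odd N with ⟨m', hm'⟩ | ⟨m', hm'⟩
  · obtain ⟨m, rfl⟩ : ∃ m, m' = m + 2 := ⟨m' - 2, by omega⟩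
    have hN' : N = 2 * m + 4 := by omega
    obtain ⟨f, rfl⟩ : ∃ f, fuel = f + 1 + m := ⟨fuel - 1 - m, by omega⟩
    subst hN'
    rw [istarIndexAux_familyA_even f hε hεu ha₁ hα ha₂ hβ ha₃ ha₄ ha₆ hγ]; omega
  · obtain ⟨m, rfl⟩ : ∃ m, m' = m + 2 := ⟨m' - 2, by omega⟩
    have hN' : N = 2 * m + 5 := by omega
    obtain ⟨f, rfl⟩ : ∃ f, fuel = f + 2 + m := ⟨fuel - 2 - m, by omega⟩
    subst hN'
    rw [istarIndexAux_familyA_odd f hε hεu ha₁ hα ha₂ hβ ha₃ ha₄ ha₆ hγ]; omega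

/-- **Family B**: `2 = ϖε`, `a₁ = 0`, `a₂ = ϖβ`, `a₃ = 0`, `ϖᴺ⁻¹ ∣ a₄`, `a₆ = ϖᴺγ` (`ε, β, γ`
units), `N ≥ 7`: with any fuel `≥ N` the `Iₙ*` sub-procedure returns `n = N - 1`.
Silverman *ATAEC* IV.9.4, Step 7. [cite: SilvermanATAEC1994, IV.9.4 Step 7 (PDF p. 346)] -/
theorem istarIndexAux_familyB {N fuel : ℕ} (hN : 7 ≤ N) (hfuel : N ≤ fuel) {W : WeierstrassCurve R}
    {ε β γ : R} (hε : (2 : R) = uniformizer R * ε) (hεu : IsUnit ε) (ha₁ : W.a₁ = 0)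
    (ha₂ : W.a₂ = uniformizer R * β) (hβ : IsUnit β) (ha₃ : W.a₃ = 0)
    (ha₄ : uniformizer R ^ (N - 1) ∣ W.a₄) (ha₆ : W.a₆ = uniformizer R ^ N * γ) (hγ : IsUnit γ) :
    istarIndexAux fuel 0 W = N - 1 := by
  rcases Nat.even_or_odd N with ⟨m', hm'⟩ | ⟨m', hm'⟩
  · obtain ⟨m, rfl⟩ : ∃ m, m' = m + 3 := ⟨m' - 3, by omega⟩
    have hN' : N = 2 * m + 6 := by omega
    obtain ⟨f, rfl⟩ : ∃ f, fuel = f + 2 + (m + 1) := ⟨fuel - 3 - m, by omega⟩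
    subst hN'
    rw [show 2 * m + 6 - 1 = 2 * m + 5 by omega] at ha₄ ⊢
    exact istarIndexAux_familyB_even f hε hεu ha₁ ha₂ hβ ha₃ ha₄ ha₆ hγ
  · obtain ⟨m, rfl⟩ : ∃ m, m' = m + 3 := ⟨m' - 3, by omega⟩
    have hN' : N = 2 * m + 7 := by omega
    obtain ⟨f, rfl⟩ : ∃ f, fuel = f + 2 + (m + 1) := ⟨fuel - 3 - m, by omega⟩
    subst hN'
    rw [show 2 * m + 7 - 1 = 2 * m + 6 by omega] at ha₄ ⊢
    exact istarIndexAux_familyB_odd f hε hεu ha₁ ha₂ hβ ha₃ ha₄ ha₆ hγ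

/-- Steps 1–7 route a model with `ϖ ∣ a₁`, `ϖ ∥ a₂`, `a₃ = 0`, `ϖ³ ∣ a₄`, `ϖ⁴ ∣ a₆`, `ϖ ∣ Δ`
(residue characteristic `2`: `ϖ ∣ 2`) to the `Iₙ*` sub-procedure on the model itself: the singular
point is already at `(0,0)`, `b₂ = a₁² + 4a₂`, `b₆ = 4a₆`, `b₈ = a₁²a₆ + 4a₂a₆ - a₄²` pass the
divisibility tests, the model is step-6 normalised, and its cubic is `T²(T + a₂,₁)`.
Silverman *ATAEC* IV.9.4, Steps 1–7. [cite: SilvermanATAEC1994, IV.9.4 Steps 1–7 (PDF pp. 344–346)] -/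
theorem kodairaSymbolOfMinimal_eq_Istar_istarIndexAux_self {W : WeierstrassCurve R} {ε β : R}
    (hε : (2 : R) = uniformizer R * ε) (h1 : uniformizer R ∣ W.a₁)
    (ha₂ : W.a₂ = uniformizer R * β) (hβ : IsUnit β) (ha₃ : W.a₃ = 0)
    (h4 : uniformizer R ^ 3 ∣ W.a₄) (h6 : uniformizer R ^ 4 ∣ W.a₆) (hΔ : uniformizer R ∣ W.Δ) :
    W.kodairaSymbolOfMinimal = .Istar (istarIndexAux (addVal R W.Δ).toNat 0 W) := by
  set ϖ := uniformizer R with hϖdef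
  have hϖ : Irreducible ϖ := irreducible_uniformizer
  have h2d : ϖ ∣ (2 : R) := ⟨ε, hε⟩
  have h4d : ϖ ∣ (4 : R) := by rw [show (4 : R) = 2 * 2 by norm_num]; exact h2d.mul_right _
  have h2 : ϖ ∣ W.a₂ := ⟨β, ha₂⟩
  have h2n : ¬ ϖ ^ 2 ∣ W.a₂ := by rw [ha₂]; exact not_sq_dvd_uniformizer_mul hβ
  obtain ⟨α, hα⟩ := h1
  obtain ⟨q, hq⟩ := h4
  obtain ⟨w, hw⟩ := h6
  obtain ⟨f, hf⟩ := h4d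
  have hb₂ : ϖ ∣ W.b₂ := by
    rw [WeierstrassCurve.b₂, hα, ha₂, hf]; exact ⟨ϖ * α ^ 2 + f * (ϖ * β), by ring⟩
  have ha₆ : ϖ ^ 2 ∣ W.a₆ := (pow_dvd_pow ϖ (by norm_num)).trans ⟨w, hw⟩
  have hb₈ : ϖ ^ 3 ∣ W.b₈ := by
    rw [WeierstrassCurve.b₈, hα, ha₂, ha₃, hq, hw, hf]
    exact ⟨ϖ ^ 3 * α ^ 2 * w + ϖ ^ 3 * f * β * w - ϖ ^ 3 * q ^ 2, by ring⟩
  have hb₆ : ϖ ^ 3 ∣ W.b₆ := by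
    rw [WeierstrassCurve.b₆, ha₃, hw, hf]; exact ⟨f * ϖ ^ 2 * w, by ring⟩
  have ha2 : redCoeff W.a₂ 1 ≠ 0 := by
    rw [ha₂, redCoeff_uniformizer_mul]; exact (isUnit_iff_residue_ne_zero β).mp hβ
  have h7 : distinctRootCount (cubicStep6 W) = 2 := by
    rw [cubicStep6, redCoeff_eq_zero_of_dvd (j := 2) ⟨q, hq⟩, redCoeff_eq_zero_of_dvd (j := 3) ⟨w, hw⟩]
    exact distinctRootCount_cube_add_C_mul_sq ha2
  have h3 : ∀ n, ϖ ^ n ∣ W.a₃ := fun n => by rw [ha₃]; exact dvd_zero _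
  have h30 : ϖ ∣ W.a₃ := by rw [ha₃]; exact dvd_zero _
  exact kodairaSymbolOfMinimal_eq_Istar_of_models (C₂ := 1) (C₆ := 1) (C₇ := 1) hΔ
    (one_smul _ W).symm h30 ((dvd_pow_self ϖ three_ne_zero).trans ⟨q, hq⟩)
    ((dvd_pow_self ϖ four_ne_zero).trans ⟨w, hw⟩) hb₂ ha₆ hb₈ hb₆ (one_smul _ W).symm ⟨α, hα⟩ h2
    (h3 2) ((pow_dvd_pow ϖ (by norm_num)).trans ⟨q, hq⟩) ((pow_dvd_pow ϖ (by norm_num)).trans ⟨w, hw⟩)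
    h7 (one_smul _ W).symm ⟨α, hα⟩ h2 h2n (h3 2) ⟨q, hq⟩ ⟨w, hw⟩

/-- **Kodaira type of family A: `Iₙ*` with `n = N - 2`** (`N ≥ 5`, `ord Δ ≥ N`; over `ℤ₂` these
are the quadratic twists by `d ≡ 3 (mod 4)` of a Tate normal form with `ord₂ j = -(N - 6)`).
Silverman *ATAEC* IV.9.4. [cite: SilvermanATAEC1994, IV.9.4 (PDF pp. 344–346)] -/
theorem kodairaSymbolOfMinimal_familyA {N : ℕ} (hN : 5 ≤ N) {W : WeierstrassCurve R}
    (hΔ : N ≤ (addVal R W.Δ).toNat) {ε α β γ : R} (hε : (2 : R) = uniformizer R * ε)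
    (hεu : IsUnit ε) (ha₁ : W.a₁ = uniformizer R * α) (hα : IsUnit α)
    (ha₂ : W.a₂ = uniformizer R * β) (hβ : IsUnit β) (ha₃ : W.a₃ = 0)
    (ha₄ : uniformizer R ^ N ∣ W.a₄) (ha₆ : W.a₆ = uniformizer R ^ N * γ) (hγ : IsUnit γ) :
    W.kodairaSymbolOfMinimal = .Istar (N - 2) := by
  set ϖ := uniformizer R with hϖdef
  have hΔ' : ϖ ∣ W.Δ := by
    have hle : ((1 : ℕ) : ℕ∞) ≤ addVal R W.Δ := by
      have h1N : (1 : ℕ) ≤ (addVal R W.Δ).toNat := le_trans (by omega) hΔ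
      by_cases htop : addVal R W.Δ = ⊤
      · rw [htop]; exact le_top
      · rw [← ENat.coe_toNat htop]; exact_mod_cast h1N
    simpa using (pow_dvd_iff_le_addVal (a := W.Δ) (n := 1)).mpr hle
  rw [kodairaSymbolOfMinimal_eq_Istar_istarIndexAux_self hε ⟨α, ha₁⟩ ha₂ hβ ha₃
    ((pow_dvd_pow ϖ (by omega)).trans ha₄) ((pow_dvd_pow ϖ (by omega)).trans ⟨γ, ha₆⟩) hΔ',
    istarIndexAux_familyA hN hΔ hε hεu ha₁ hα ha₂ hβ ha₃ ha₄ ha₆ hγ]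

/-- **Kodaira type of family B: `Iₙ*` with `n = N - 1`** (`N ≥ 7`, `ord Δ ≥ N`; over `ℤ₂` these
are the quadratic twists by `d` with `2 ∥ d` of a Tate normal form with `ord₂ j = -(N - 9)`).
Silverman *ATAEC* IV.9.4. [cite: SilvermanATAEC1994, IV.9.4 (PDF pp. 344–346)] -/
theorem kodairaSymbolOfMinimal_familyB {N : ℕ} (hN : 7 ≤ N) {W : WeierstrassCurve R}
    (hΔ : N ≤ (addVal R W.Δ).toNat) {ε β γ : R} (hε : (2 : R) = uniformizer R * ε)
    (hεu : IsUnit ε) (ha₁ : W.a₁ = 0) (ha₂ : W.a₂ = uniformizer R * β) (hβ : IsUnit β)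
    (ha₃ : W.a₃ = 0) (ha₄ : uniformizer R ^ (N - 1) ∣ W.a₄)
    (ha₆ : W.a₆ = uniformizer R ^ N * γ) (hγ : IsUnit γ) :
    W.kodairaSymbolOfMinimal = .Istar (N - 1) := by
  set ϖ := uniformizer R with hϖdef
  have hΔ' : ϖ ∣ W.Δ := by
    have hle : ((1 : ℕ) : ℕ∞) ≤ addVal R W.Δ := by
      have h1N : (1 : ℕ) ≤ (addVal R W.Δ).toNat := le_trans (by omega) hΔ
      by_cases htop : addVal R W.Δ = ⊤
      · rw [htop]; exact le_top
      · rw [← ENat.coe_toNat htop]; exact_mod_cast h1N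
    simpa using (pow_dvd_iff_le_addVal (a := W.Δ) (n := 1)).mpr hle
  rw [kodairaSymbolOfMinimal_eq_Istar_istarIndexAux_self hε (by rw [ha₁]; exact dvd_zero _) ha₂ hβ
    ha₃ ((pow_dvd_pow ϖ (by omega)).trans ha₄) ((pow_dvd_pow ϖ (by omega)).trans ⟨γ, ha₆⟩) hΔ',
    istarIndexAux_familyB hN hΔ hε hεu ha₁ ha₂ hβ ha₃ ha₄ ha₆ hγ]

end Wrappers

end TateAlgorithm

end Literature.NumberTheory.DiophantineGeometry
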